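import Summits.ResolutionOfSingularities.ResolutionOfSingularities.Theorems.PurelyInseparableDim4E2OfCJSLocalizePrime
import Summits.ResolutionOfSingularities.ResolutionOfSingularities.Theorems.PurelyInseparableDim4E2OfCJSLocalizePrimeProof
import Summits.ResolutionOfSingularities.ResolutionOfSingularities.Theorems.PurelyInseparableDim4E2StrictTransformPrime
import Summits.ResolutionOfSingularities.ResolutionOfSingularities.Theorems.PurelyInseparableDim4E2IsolationPrime
import Summits.ResolutionOfSingularities.ResolutionOfSingularities.Theorems.PurelyInseparableDim4WideBaseChange
import HarnessLib

/-!
# FOR EVERY PRIME p ≥ 3: `NoWideTrap p p` FROM COSSART–JANNSEN–SAITO THM 6.40 ALONE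
# (the p-PROGRAM of the E2 dictionary ASSEMBLED — cell `res-dim4-pi`, WORD #66; every p-row a theorem by name)

[OURS · counted 0 · AI work weaker than expert review.]  Cell `res-dim4-pi` (D-0157 DOOR 2), seat `res-dim4-p-2`
g2 (holder).  NOTHING here proves Cossart–Jannsen–Saito's Theorem 6.40 itself (it enters as the NAMED FACT F-111
`KeyTheorem640_char_localized_isolated`, a hypothesis), K2(p) = `NoAboveFloorTrap p p`, F4-I(p,p)
unconditionally, or resolution of singularities in dimension ≥ 4 / characteristic `p`.

THE p-ROW TABLE (all in the tree): (N_p) `nearRowP`, (E_p) `directrixRowP` (res-dim4-p-3 g2, p669735, over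
res-dim4-p-1/p-5 g2's p-generic content) · (I_p) `isolationRowP` (res-dim4-p-11 g2, p670559) · (X_p) `settingRowP`
(p669826 + LocalizePrime) · (M-a_p) `globalModelP_of_coneTwoChain` (p669974) · (M-b_p) content
`Prime.localizationRow_of_strictTransform` (res-dim4-p-7 g2, p670537) · (M-c_p) `strictTransformBlowupP_prime`
(res-dim4-p-11 g2, p670586) · base change `RidgeBudget.noWideTrap_of_forall_isAlgClosed_coneTwo` (res-dim4-p-1 g2,
p670597).  Hence, sorry-free and by name, for every prime `p ≥ 3`:

* `strictTransformBlowupP_holds : StrictTransformBlowupP p`, `localizationRowP_holds : LocalizationRowP p`,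
  `modelRowP : ModelRowP p`;
* `no_coneTwo_chain_of_KeyTheorem640` — no isolated cone-two chain over any algebraically closed field of
  characteristic `p ≥ 3`, from F-111;
* **`noWideTrap_of_KeyTheorem640 (p) (hp3 : 3 ≤ p) : KeyTheorem640_char_localized_isolated → NoWideTrap p p`** —
  so that, with res-dim4-p-12 g2's ridge residual trichotomy, F4-I(p,p) ⟸ F-111 ∧ K2(p) and K2(p) =
  `NoAboveFloorTrap p p` is the ONLY open OURS letter of F4-I(p,p) for `p ≥ 5`.

bears_on: LADDER-RESOLUTION:D157-DOOR2 (res-dim4-pi · F4-I(p,p) · CJS dictionary · p-assembly).  Supports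
stmt-ResolutionOfSingularities-16155 (helper).
-/

set_option linter.dupNamespace false -- mandated namespace of this single-conjunct summit

noncomputable section

open Literature.AlgebraicGeometry.CossartJannsenSaito2020
open Literature.AlgebraicGeometry.Resolution.Hauser2010

namespace Summit.ResolutionOfSingularities.ResolutionOfSingularities.Theorems.PIDim4

namespace E2OfCJS

open RidgeBudget (ebar NoWideTrap noWideTrap_of_forall_isAlgClosed_coneTwo)

/-- **ROW (M-c_p) BY NAME**: res-dim4-p-11 g2's `strictTransformBlowupP_prime` IS a proof of the typed row
`StrictTransformBlowupP p` (same text). [OURS · row M-c_p] [cite: Kollar2007, 3.30.2] -/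
theorem strictTransformBlowupP_holds (p : ℕ) [Fact p.Prime] : StrictTransformBlowupP p :=
  strictTransformBlowupP_prime p

/-- **(M-c_p) ⇒ (M-b_p) BY NAME**: res-dim4-p-7 g2's unfolded localisation at the prime `p`
(`Prime.localizationRow_of_strictTransform`) read as the typed implication. [OURS · row M-b_p]
[cite: CossartJannsenSaito2020, p. 107, Def. 6.38 / 6.39] -/
theorem localizationRowP_of_strictTransformBlowupP (p : ℕ) [Fact p.Prime] (h : StrictTransformBlowupP p) :
    LocalizationRowP p :=
  fun K _ _ _ _ c hc Z hZ hJ M x hx φ hφ π hall =>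
    Prime.localizationRow_of_strictTransform p h K c hc Z hZ hJ M x hx φ hφ π hall

/-- **ROW (M-b_p) HOLDS for every prime `p`.** [OURS · row M-b_p] [folklore] -/
theorem localizationRowP_holds (p : ℕ) [Fact p.Prime] : LocalizationRowP p :=
  localizationRowP_of_strictTransformBlowupP p (strictTransformBlowupP_holds p)

/-- **ROW (M_p) `ModelRowP p` HOLDS for every prime `p`** ((M-a_p) ∧ (M-b_p) ∧ (M-c_p)). [OURS · row M_p]
[folklore] -/
theorem modelRowP (p : ℕ) [Fact p.Prime] : ModelRowP p :=
  modelRowP_of_localizationRowP p (localizationRowP_holds p)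

/-- **The transfer row at the prime `p ≥ 3` over algebraically closed fields HOLDS**
(`IsolatedConeTwoChainLocalizesAlgClosedP p`: rows (M_p)(N_p)(E_p)(I_p)(X_p) by name). [OURS · transfer row at p]
[folklore] -/
theorem isolatedConeTwoChainLocalizesAlgClosedP (p : ℕ) [Fact p.Prime] (hp3 : 3 ≤ p) :
    IsolatedConeTwoChainLocalizesAlgClosedP p :=
  isolatedConeTwoChainLocalizesAlgClosedP_of_rows p (modelRowP p) (nearRowP p) (directrixRowP p) (isolationRowP p)
    (settingRowP p hp3)

/-- **NO ISOLATED CONE-TWO CHAIN over an algebraically closed field of characteristic `p ≥ 3`, from CJS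
Thm. 6.40 (F-111) ALONE.** [OURS · conditional on a NAMED PUBLISHED FACT only]
[cite: CossartJannsenSaito2020, Thm. 6.40] -/
theorem no_coneTwo_chain_of_KeyTheorem640 (p : ℕ) [Fact p.Prime] (hp3 : 3 ≤ p)
    (hK640 : KeyTheorem640_char_localized_isolated.{0}) (K : Type) [Field K] [CharP K p] [IsAlgClosed K]
    [DecidableEq K] :
    ¬ ∃ c : ℕ → State K, ∀ k, IsIsolated p (c k).F ∧ Step0 p (c k) (c (k + 1)) ∧
      ordZero (c k).F = (p : ℕ∞) ∧ ebar (c k).F = 2 :=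
  no_coneTwo_chain_of_CJS_of_localization_isolationP p hp3 hK640 (localizationRowP_holds p) (isolationRowP p) K

/-- **FOR EVERY PRIME `p ≥ 3`: `NoWideTrap p p` FROM CJS THM. 6.40 ALONE.**  There is no infinite isolated chain of
point blow-ups of the purely inseparable frame `z^p + F(x₀,…,x₃)` on the WIDE floor (`ord = p`, `ē = 2`) in
characteristic `p`, granted the named fact `KeyTheorem640_char_localized_isolated` (Cossart–Jannsen–Saito, LNM
2270, Thm. 6.40, unit-wise localised isolated form; (F1) «char ≥ dim/2 + 1» holds in dimension 4 exactly for
`p ≥ 3`).  Over an arbitrary field the chain is moved to the algebraic closure by res-dim4-p-1 g2's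
`RidgeBudget.noWideTrap_of_forall_isAlgClosed_coneTwo` (`ebar` and `ordZero` are invariant, CJS Lemma 2.20 (2)).
[OURS · conditional on a NAMED PUBLISHED FACT only] [cite: CossartJannsenSaito2020, Thm. 6.40] -/
theorem noWideTrap_of_KeyTheorem640 (p : ℕ) [Fact p.Prime] (hp3 : 3 ≤ p)
    (hK640 : KeyTheorem640_char_localized_isolated.{0}) : NoWideTrap p p :=
  noWideTrap_of_forall_isAlgClosed_coneTwo p fun L _ _ _ _ => no_coneTwo_chain_of_KeyTheorem640 p hp3 hK640 L

/-- Sanity at `p = 3`: the p-assembly re-proves `NoWideTrap 3 3` from F-111 (agrees with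
`noWideTrap_three_three_of_KeyTheorem640`, p669463). [OURS · adapter] [folklore] -/
theorem noWideTrap_three_three_of_KeyTheorem640' (hK640 : KeyTheorem640_char_localized_isolated.{0}) :
    NoWideTrap 3 3 :=
  haveI : Fact (Nat.Prime 3) := ⟨Nat.prime_three⟩
  noWideTrap_of_KeyTheorem640 3 le_rfl hK640

end E2OfCJS

end Summit.ResolutionOfSingularities.ResolutionOfSingularities.Theorems.PIDim4

end
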